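import Summits.PneNP.PneNP.Theorems.Nc03AvoidResidualCoreCandMatchRungPack

/-!
# Route Nc03AvoidResidualCore — a BC5 rung for `CandAvoidLinearFP` (C₁) INSIDE the matching-class core, part 2/2: existence of aligned packs and the rung

Tribunal-w witness, generation 3 (D-0033 T3) for `route-PneNP-Nc03AvoidResidualCore`, item
`stmt-PneNP-20226`; part 1 is `Nc03AvoidResidualCoreCandMatchRungPack` (the gadget / aligned-pack
certificate and its soundness, and the vacuity of the few-heads certificates on matching-class
instances).

**Theorem (matching-class rung, `candMatch_rung`).** For every `k`: on pure `CAND` instances with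
matching classes (`IsMatchingClass`) and `headCount³ ≤ k·n` (at most `(kn)^{1/3}` head classes;
classes of any size, pair graph of any girth), ONE explicit avoider `candMatchAvoid` (a search over the
`m²⁴` candidate packs, each tested by `packB` in time `poly(n)`) solves range avoidance for all `n ≥ 1`
at stretch `m ≥ (22k+1)·n`.

Existence of a pack (`exists_pack`): in a matching-class instance a gadget of a given signature is
determined by its middle (the flank at `u_j` of class `c_u` is THE `c_u`-edge at `u_j`, `fiber_ext`);
all but `≤ n` outputs are middles of gadgets (`card_lonely_le`, `le_card_gadgets`), so some signature
carries `> 21` gadgets as soon as `m − n ≥ 22·headCount³` (pigeonhole over the `headCount³` signatures,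
`exists_crowded_fiber`); same-signature gadgets conflict (share an output) with at most two others
(`card_conflict_le_two`), so eight pairwise disjoint ones are extracted greedily (`exists_indep`).

Placement. A RESTRICTED-MODEL algorithmic rung of the range-avoidance ladder: pure `CAND` is outside
the monotone / symmetric / `NC⁰₂` classes of [KuntewarSarma2025, Thms. 2, 8] and [GuruswamiLyuWang2022],
the stretch `(22k+1)·n` is below the general `NC⁰₃` threshold `c·n·log n` of
[GuruswamiLyuYuan2025, Thm. 1.3], and the few-heads rung is vacuous on this family. It shows that
bounded-size unsatisfiable output patterns persist in the matching-class core up to `n^{1/3}` head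
classes; the regime `headCount ≫ n^{1/3}` (classes of bounded size) is untouched. It does not decide
`Nc03AvoidLinearFP` and has no bearing on `P` versus `NP`.
-/

set_option linter.dupNamespace false -- `Summit.PneNP.PneNP.…`: summit = sub-problem name (D-0017 single-conjunct layout)

namespace Summit.PneNP.PneNP.Theorems.Nc03AvoidResidualCoreCandMatchRung

open Finset
open Literature.Computability.Complexity
open Summit.PneNP.PneNP.Theorems.Nc03AvoidResidualCoreCandFewHeadsRung

variable {n m : ℕ}

/-! ## Matching-class instances: canonical gadgets and the existence of an aligned pack -/

/-- The GADGETS of an instance: triples `(ju, j, jv)` with `u_j ∈ data(ju)`, `v_j ∈ data(jv)` and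
`ju, jv ≠ j`. -/
def gadgets (I : LocalMap 3 n m) : Finset (Fin m × Fin m × Fin m) :=
  univ.filter fun g => g.1 ≠ g.2.1 ∧ I.vars g.2.1 1 ∈ pset I g.1 ∧ g.2.2 ≠ g.2.1 ∧ I.vars g.2.1 2 ∈ pset I g.2.2

/-- The head signature `(c_u, c, c_v)` of a triple. -/
def sig (I : LocalMap 3 n m) (g : Fin m × Fin m × Fin m) : Fin n × Fin n × Fin n :=
  (I.vars g.1 0, I.vars g.2.1 0, I.vars g.2.2 0)

/-- The LONELY outputs: one of their data vertices lies in no other output. -/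
def lonely (I : LocalMap 3 n m) : Finset (Fin m) :=
  univ.filter fun j => (∀ j', j' ≠ j → I.vars j 1 ∉ pset I j') ∨ (∀ j', j' ≠ j → I.vars j 2 ∉ pset I j')

/-- At most `n` outputs are lonely (map a lonely output to a private data vertex: an injection). -/
theorem card_lonely_le (I : LocalMap 3 n m) : #(lonely I) ≤ n := by
  classical
  let f : Fin m → Fin n := fun j =>
    if (∀ j', j' ≠ j → I.vars j 1 ∉ pset I j') then I.vars j 1 else I.vars j 2
  have hf : ∀ j, f j ∈ pset I j := by
    intro j
    simp only [f]
    split_ifs <;> simp [pset]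
  calc #(lonely I) ≤ #(univ : Finset (Fin n)) := by
        refine Finset.card_le_card_of_injOn f (fun _ _ => Finset.mem_coe.mpr (Finset.mem_univ _)) ?_
        intro j₁ hj₁ j₂ _ heq
        by_contra hne
        have m1 : f j₁ ∈ pset I j₂ := by rw [heq]; exact hf j₂
        rw [Finset.mem_coe, lonely, Finset.mem_filter] at hj₁
        by_cases hu : ∀ j', j' ≠ j₁ → I.vars j₁ 1 ∉ pset I j'
        · have e1 : f j₁ = I.vars j₁ 1 := by simp only [f, if_pos hu]
          exact hu j₂ (Ne.symm hne) (e1 ▸ m1)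
        · have e2 : f j₁ = I.vars j₁ 2 := by simp only [f, if_neg hu]
          rcases hj₁.2 with h | h
          · exact hu h
          · exact h j₂ (Ne.symm hne) (e2 ▸ m1)
    _ = n := by rw [Finset.card_univ, Fintype.card_fin]

/-- Every output that is not lonely is the middle of a gadget; hence there are at least `m − n`
gadgets. -/
theorem le_card_gadgets (I : LocalMap 3 n m) : m ≤ #(gadgets I) + n := by
  classical
  have hsplit := Finset.card_filter_add_card_filter_not (s := (univ : Finset (Fin m))) (fun j => j ∈ lonely I)
  rw [Finset.card_univ, Fintype.card_fin] at hsplit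
  have h1 : #(univ.filter fun j : Fin m => j ∈ lonely I) ≤ n :=
    le_trans (Finset.card_le_card fun j hj => (Finset.mem_filter.mp hj).2) (card_lonely_le I)
  have h2 : #(univ.filter fun j : Fin m => ¬ j ∈ lonely I) ≤ #(gadgets I) := by
    refine le_trans (Finset.card_le_card ?_) (Finset.card_image_le (f := fun g => g.2.1) (s := gadgets I))
    intro j hj
    rw [Finset.mem_filter, lonely, Finset.mem_filter, not_and, not_or] at hj
    obtain ⟨hnu, hnv⟩ := hj.2 (Finset.mem_univ _)
    push Not at hnu hnv
    obtain ⟨ju, hju, hu⟩ := hnu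
    obtain ⟨jv, hjv, hv⟩ := hnv
    rw [Finset.mem_image]
    refine ⟨(ju, j, jv), ?_, rfl⟩
    rw [gadgets, Finset.mem_filter]
    exact ⟨Finset.mem_univ _, hju, hu, hjv, hv⟩
  omega

/-- CONFLICT of two triples (Boolean test): a shared middle, or a flank of one equal to a flank of
the other. -/
def conflictB (g g' : Fin m × Fin m × Fin m) : Bool :=
  decide (g.2.1 = g'.2.1 ∨ g.1 = g'.1 ∨ g.1 = g'.2.2 ∨ g.2.2 = g'.1 ∨ g.2.2 = g'.2.2)

/-- Conflict is symmetric. -/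
theorem conflict_symm {g g' : Fin m × Fin m × Fin m} (h : conflictB g g' = true) :
    conflictB g' g = true := by
  simp only [conflictB, decide_eq_true_eq] at h ⊢
  rcases h with h | h | h | h | h
  · exact Or.inl h.symm
  · exact Or.inr (Or.inl h.symm)
  · exact Or.inr (Or.inr (Or.inr (Or.inl h.symm)))
  · exact Or.inr (Or.inr (Or.inl h.symm))
  · exact Or.inr (Or.inr (Or.inr (Or.inr h.symm)))

section Existence

variable {I : LocalMap 3 n m}

/-- The gadgets of a fixed signature `σ`. -/
def fiber (I : LocalMap 3 n m) (σ : Fin n × Fin n × Fin n) : Finset (Fin m × Fin m × Fin m) :=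
  (gadgets I).filter fun g => sig I g = σ

/-- Unpacking membership in a fiber. -/
theorem mem_fiber {σ : Fin n × Fin n × Fin n} {g : Fin m × Fin m × Fin m} (hg : g ∈ fiber I σ) :
    (g.1 ≠ g.2.1 ∧ I.vars g.2.1 1 ∈ pset I g.1 ∧ g.2.2 ≠ g.2.1 ∧ I.vars g.2.1 2 ∈ pset I g.2.2) ∧
      I.vars g.1 0 = σ.1 ∧ I.vars g.2.1 0 = σ.2.1 ∧ I.vars g.2.2 0 = σ.2.2 := by
  rw [fiber, Finset.mem_filter, gadgets, Finset.mem_filter] at hg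
  obtain ⟨⟨-, hg⟩, hs⟩ := hg
  subst hs
  exact ⟨hg, rfl, rfl, rfl⟩

/-- In a matching-class instance a gadget of a given signature is determined by its middle (the flank
at `u_j` of class `c_u` is THE `c_u`-edge at `u_j`). -/
theorem fiber_ext (hM : IsMatchingClass I) {σ : Fin n × Fin n × Fin n} {g g' : Fin m × Fin m × Fin m}
    (hg : g ∈ fiber I σ) (hg' : g' ∈ fiber I σ) (hmid : g.2.1 = g'.2.1) : g = g' := by
  obtain ⟨⟨_, hu, _, hv⟩, s1, _, s3⟩ := mem_fiber hg
  obtain ⟨⟨_, hu', _, hv'⟩, s1', _, s3'⟩ := mem_fiber hg'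
  rw [hmid] at hu hv
  refine Prod.ext ?_ (Prod.ext hmid ?_)
  · exact eq_of_mem_pset hM (s1.trans s1'.symm) hu hu'
  · exact eq_of_mem_pset hM (s3.trans s3'.symm) hv hv'

/-- The flank classes differ from the middle class: `c_u ≠ c` and `c_v ≠ c`. -/
theorem sig_ne (hM : IsMatchingClass I) {σ : Fin n × Fin n × Fin n} {g : Fin m × Fin m × Fin m}
    (hg : g ∈ fiber I σ) : σ.1 ≠ σ.2.1 ∧ σ.2.2 ≠ σ.2.1 := by
  obtain ⟨⟨hju, hu, hjv, hv⟩, s1, s2, s3⟩ := mem_fiber hg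
  constructor
  · intro h
    exact hju (eq_of_mem_pset hM (s1.trans (h.trans s2.symm)) hu (by simp [pset]))
  · intro h
    exact hjv (eq_of_mem_pset hM (s3.trans (h.trans s2.symm)) hv (by simp [pset]))

/-- **Conflict degree at most two.** Within a signature fiber of a matching-class pure `CAND`
instance, a gadget `(ju, j, jv)` with `data(ju) = {u_j, w}`, `data(jv) = {v_j, w'}` conflicts only
with the gadgets whose middle is the `c`-edge at `w` or at `w'`. -/
theorem card_conflict_le_two (hI : I.IsPure candPred) (hM : IsMatchingClass I)
    {σ : Fin n × Fin n × Fin n} {g : Fin m × Fin m × Fin m} (hg : g ∈ fiber I σ) :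
    #((fiber I σ).filter fun g' => g' ≠ g ∧ conflictB g g' = true) ≤ 2 := by
  classical
  obtain ⟨⟨hju, hu, hjv, hv⟩, s1, s2, s3⟩ := mem_fiber hg
  obtain ⟨w, -, hw⟩ := exists_other (pset_card hI g.1) hu
  obtain ⟨w', -, hw'⟩ := exists_other (pset_card hI g.2.2) hv
  -- at most one gadget of the fiber has its middle through a given vertex
  have hone : ∀ z : Fin n, #((fiber I σ).filter fun g' => z ∈ pset I g'.2.1) ≤ 1 := by
    intro z
    rw [Finset.card_le_one]
    intro a ha b hb
    rw [Finset.mem_filter] at ha hb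
    refine fiber_ext hM ha.1 hb.1 (eq_of_mem_pset hM ?_ ha.2 hb.2)
    rw [(mem_fiber ha.1).2.2.1, (mem_fiber hb.1).2.2.1]
  have hsub : ((fiber I σ).filter fun g' => g' ≠ g ∧ conflictB g g' = true) ⊆
      ((fiber I σ).filter fun g' => w ∈ pset I g'.2.1) ∪ ((fiber I σ).filter fun g' => w' ∈ pset I g'.2.1) := by
    intro g' hg'
    rw [Finset.mem_filter] at hg'
    obtain ⟨hg'F, hne, hR⟩ := hg'
    obtain ⟨⟨_, hu', _, hv'⟩, s1', s2', s3'⟩ := mem_fiber hg'F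
    rw [Finset.mem_union, Finset.mem_filter, Finset.mem_filter]
    -- the middles are distinct edges of the same class, hence vertex-disjoint
    have hjj : g.2.1 ≠ g'.2.1 := fun h => hne (fiber_ext hM hg hg'F h).symm
    have hcc : I.vars g.2.1 0 = I.vars g'.2.1 0 := s2.trans s2'.symm
    have hdisj : ∀ z, z ∈ pset I g.2.1 → z ∈ pset I g'.2.1 → False :=
      fun z hz hz' => hjj (eq_of_mem_pset hM hcc hz hz')
    have hug : I.vars g.2.1 1 ∈ pset I g.2.1 := by simp [pset]
    have hvg : I.vars g.2.1 2 ∈ pset I g.2.1 := by simp [pset]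
    have hug' : I.vars g'.2.1 1 ∈ pset I g'.2.1 := by simp [pset]
    have hvg' : I.vars g'.2.1 2 ∈ pset I g'.2.1 := by simp [pset]
    simp only [conflictB, decide_eq_true_eq] at hR
    rcases hR with h | h | h | h | h
    · exact absurd h hjj
    · -- shared u-flank: `u_{j'} ∈ data(ju) = {u_j, w}`
      rw [← h, hw, Finset.mem_insert, Finset.mem_singleton] at hu'
      rcases hu' with e | e
      · exact absurd (e ▸ hug' : I.vars g.2.1 1 ∈ pset I g'.2.1) (fun hh => hdisj _ hug hh)
      · exact Or.inl ⟨hg'F, e ▸ hug'⟩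
    · -- `ju = jv'`: `v_{j'} ∈ data(ju) = {u_j, w}`
      rw [← h, hw, Finset.mem_insert, Finset.mem_singleton] at hv'
      rcases hv' with e | e
      · exact absurd (e ▸ hvg' : I.vars g.2.1 1 ∈ pset I g'.2.1) (fun hh => hdisj _ hug hh)
      · exact Or.inl ⟨hg'F, e ▸ hvg'⟩
    · -- `jv = ju'`: `u_{j'} ∈ data(jv) = {v_j, w'}`
      rw [← h, hw', Finset.mem_insert, Finset.mem_singleton] at hu'
      rcases hu' with e | e
      · exact absurd (e ▸ hug' : I.vars g.2.1 2 ∈ pset I g'.2.1) (fun hh => hdisj _ hvg hh)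
      · exact Or.inr ⟨hg'F, e ▸ hug'⟩
    · -- shared v-flank
      rw [← h, hw', Finset.mem_insert, Finset.mem_singleton] at hv'
      rcases hv' with e | e
      · exact absurd (e ▸ hvg' : I.vars g.2.1 2 ∈ pset I g'.2.1) (fun hh => hdisj _ hvg hh)
      · exact Or.inr ⟨hg'F, e ▸ hvg'⟩
  calc #((fiber I σ).filter fun g' => g' ≠ g ∧ conflictB g g' = true)
      ≤ #(((fiber I σ).filter fun g' => w ∈ pset I g'.2.1) ∪
          ((fiber I σ).filter fun g' => w' ∈ pset I g'.2.1)) := Finset.card_le_card hsub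
    _ ≤ #((fiber I σ).filter fun g' => w ∈ pset I g'.2.1) + #((fiber I σ).filter fun g' => w' ∈ pset I g'.2.1) :=
        Finset.card_union_le _ _
    _ ≤ 1 + 1 := Nat.add_le_add (hone w) (hone w')

/-- **A crowded signature.** With matching classes, `headCount³ ≤ k·n` and `m ≥ (22k+1)·n ≥ 1`, some
signature carries more than `21` gadgets (pigeonhole over the `headCount³` signatures of the
`≥ m − n` gadgets). -/
theorem exists_crowded_fiber {k : ℕ} (hk : headCount I ^ 3 ≤ k * n) (hn : 0 < n)
    (hm : (22 * k + 1) * n ≤ m) : ∃ σ, 21 < #(fiber I σ) := by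
  classical
  set H : Finset (Fin n) := univ.image fun j => I.vars j 0 with hH
  have hmaps : ∀ g ∈ gadgets I, sig I g ∈ H ×ˢ (H ×ˢ H) := by
    intro g _
    simp only [sig, Finset.mem_product, hH, Finset.mem_image, Finset.mem_univ, true_and]
    exact ⟨⟨_, rfl⟩, ⟨_, rfl⟩, ⟨_, rfl⟩⟩
  have hm1 : 1 ≤ m := le_trans hn (le_trans (Nat.le_mul_of_pos_left n (by omega)) hm)
  have hH1 : 1 ≤ #H := by
    rw [Nat.one_le_iff_ne_zero, Ne, Finset.card_eq_zero, hH, Finset.image_eq_empty]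
    intro h
    have := Finset.card_eq_zero.mpr h
    rw [Finset.card_univ, Fintype.card_fin] at this
    omega
  have hcard : #(H ×ˢ (H ×ˢ H)) * 21 < #(gadgets I) := by
    rw [Finset.card_product, Finset.card_product]
    have hG := le_card_gadgets I
    have hpow : headCount I ^ 3 = #H * (#H * #H) := by rw [headCount, ← hH]; ring
    rw [hpow] at hk
    have hT1 : 1 ≤ #H * (#H * #H) := Nat.one_le_iff_ne_zero.mpr (by positivity)
    have hm' : 22 * (k * n) + n ≤ m := by nlinarith [hm]
    omega
  obtain ⟨σ, -, hσ⟩ := Finset.exists_lt_card_fiber_of_mul_lt_card_of_maps_to hmaps hcard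
  exact ⟨σ, by simpa [fiber] using hσ⟩

/-- **Existence of an aligned pack** in matching-class pure `CAND` instances with
`headCount³ ≤ k·n`, `n ≥ 1` and `m ≥ (22k+1)·n`. -/
theorem exists_pack (hI : I.IsPure candPred) (hM : IsMatchingClass I) {k : ℕ}
    (hk : headCount I ^ 3 ≤ k * n) (hn : 0 < n) (hm : (22 * k + 1) * n ≤ m) :
    ∃ t : Pack m, packB I t = true := by
  classical
  obtain ⟨σ, hσ⟩ := exists_crowded_fiber hk hn hm
  obtain ⟨A, hAF, hAcard, hA⟩ := exists_indep conflictB (fun _ _ => conflict_symm) 8 (fiber I σ)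
    (fun g hg => card_conflict_le_two hI hM hg) (by omega)
  let e := A.equivFinOfCardEq hAcard
  let t : Pack m := fun i => (e.symm i).1
  have htF : ∀ i, t i ∈ fiber I σ := fun i => hAF (e.symm i).2
  have htne : ∀ i i', i ≠ i' → ¬ conflictB (t i) (t i') = true := by
    intro i i' hii
    refine hA _ (e.symm i).2 _ (e.symm i').2 fun h => hii ?_
    exact e.symm.injective (Subtype.ext h)
  obtain ⟨hcu_ne, hcv_ne⟩ := sig_ne hM (htF 0)
  refine ⟨t, ?_⟩
  simp only [packB, decide_eq_true_eq]
  refine ⟨fun i => ?_, fun i => ?_, fun i => ?_, fun i => (mem_fiber (htF i)).1.2.1,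
    fun i => (mem_fiber (htF i)).1.2.2.2, fun i i' h => ?_, fun i i' h => ?_, fun i i' hii => ?_⟩
  · rw [(mem_fiber (htF i)).2.2.1, (mem_fiber (htF 0)).2.2.1]
  · rw [(mem_fiber (htF i)).2.1, (mem_fiber (htF 0)).2.1]
  · rw [(mem_fiber (htF i)).2.2.2, (mem_fiber (htF 0)).2.2.2]
  · exact hcu_ne (((mem_fiber (htF i)).2.1).symm.trans ((congrArg (fun j => I.vars j 0) h).trans
      (mem_fiber (htF i')).2.2.1))
  · exact hcv_ne (((mem_fiber (htF i)).2.2.2).symm.trans ((congrArg (fun j => I.vars j 0) h).trans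
      (mem_fiber (htF i')).2.2.1))
  · have hR := htne i i' hii
    simp only [conflictB, decide_eq_true_eq, not_or] at hR
    exact ⟨hR.1, hR.2.1, hR.2.2.1, hR.2.2.2.2⟩

end Existence

/-! ## The explicit avoider and the rung -/

/-- All functions `Fin k → β` with values drawn from a list (for the exhaustive candidate search). -/
def allFns {β : Type*} (vals : List β) : (k : ℕ) → List (Fin k → β)
  | 0 => [fun i => i.elim0]
  | k + 1 => vals.flatMap fun b => (allFns vals k).map fun f => Fin.cons b f

/-- The enumeration is exhaustive when the value list is. -/
theorem mem_allFns {β : Type*} {vals : List β} (hv : ∀ b, b ∈ vals) :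
    ∀ (k : ℕ) (f : Fin k → β), f ∈ allFns vals k
  | 0, f => by
    rw [allFns, List.mem_singleton]
    funext i
    exact i.elim0
  | k + 1, f => by
    rw [allFns, List.mem_flatMap]
    exact ⟨f 0, hv _, List.mem_map.mpr ⟨Fin.tail f, mem_allFns hv k _, Fin.cons_self_tail f⟩⟩

/-- The `m²⁴` candidate packs. -/
def candidates (m : ℕ) : List (Pack m) :=
  allFns (List.finRange m ×ˢ (List.finRange m ×ˢ List.finRange m)) 8

/-- Every pack is a candidate. -/
theorem mem_candidates (t : Pack m) : t ∈ candidates m :=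
  mem_allFns (fun ⟨a, b, c⟩ => List.pair_mem_product.mpr
    ⟨List.mem_finRange a, List.pair_mem_product.mpr ⟨List.mem_finRange b, List.mem_finRange c⟩⟩) 8 t

/-- **The explicit avoider** for matching-class pure `CAND` instances: search the candidate packs for
one passing the aligned-pack test and answer with its certificate; else answer `0…0`. -/
def candMatchAvoid (I : LocalMap 3 n m) : Fin m → Bool :=
  match (candidates m).find? (packB I) with
  | some t => packAnswer t
  | none => fun _ => false

/-- **Matching-class rung, sharp form.** For a matching-class pure `CAND` instance with
`headCount³ ≤ k·n`, `n ≥ 1` and `m ≥ (22k+1)·n` outputs the explicit avoider returns a point outside the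
range. -/
theorem candMatchAvoid_not_mem_range {I : LocalMap 3 n m} (hI : I.IsPure candPred)
    (hM : IsMatchingClass I) {k : ℕ} (hk : headCount I ^ 3 ≤ k * n) (hn : 0 < n)
    (hm : (22 * k + 1) * n ≤ m) : candMatchAvoid I ∉ I.range := by
  unfold candMatchAvoid
  split
  · rename_i t ht
    exact packAnswer_not_mem_range hI (List.find?_some ht)
  · rename_i hnone
    exfalso
    obtain ⟨t, ht⟩ := exists_pack hI hM hk hn hm
    exact List.find?_eq_none.mp hnone t (mem_candidates t) ht

/-- **Matching-class rung, ladder form** (BC5 / T3 witness for C₁ inside the matching-class family):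
for every `k`, ONE explicit avoider solves pure-`CAND` range avoidance on the matching-class instances
with `headCount³ ≤ k·n`, for all `n ≥ 1`, at stretch `m ≥ (22k+1)·n` — the shape of
`LocalAvoidLinearFP 3 (IsPure candPred ∧ IsMatchingClass ∧ headCount³ ≤ k·n)` with the answer given
directly as a point of `{0,1}ᵐ`. -/
theorem candMatch_rung (k : ℕ) :
    ∀ n m (I : LocalMap 3 n m), (I.IsPure candPred ∧ IsMatchingClass I ∧ headCount I ^ 3 ≤ k * n) →
      0 < n → (22 * k + 1) * n ≤ m → candMatchAvoid I ∉ I.range :=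
  fun _ _ _ hQ hn hm => candMatchAvoid_not_mem_range hQ.1 hQ.2.1 hQ.2.2 hn hm

/-- The literal FP-typed form of the rung is a special case of the crux
C₁ = `CandAvoidLinearFP = LocalAvoidLinearFP 3 (IsPure candPred)` (antitonicity of
`LocalAvoidLinearFP` in the side condition); its direct proof is the same search run on `encode I`
(plan-only: the `IsPolyTime` wrapper is machine bookkeeping in the tree's `CodeFP` algebra, as done for
the few-heads rung in `Nc03AvoidResidualCoreCandFewHeadsRungFP`). -/
theorem candAvoidLinearFP_imp_candMatch (k : ℕ)
    (h : LocalAvoidLinearFP 3 (fun _ _ I => I.IsPure candPred)) :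
    LocalAvoidLinearFP 3 (fun n _ I => I.IsPure candPred ∧ IsMatchingClass I ∧ headCount I ^ 3 ≤ k * n) := by
  obtain ⟨C, f, hf, hC⟩ := h
  exact ⟨C, f, hf, fun n m I hI hn hm => hC n m I hI.1 hn hm⟩

end Summit.PneNP.PneNP.Theorems.Nc03AvoidResidualCoreCandMatchRung
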